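import Summits.QuantumFields.YangMills.Theorems.UnitScaleTiltHalvingP1FlatPillarPrime
import HarnessLib

/-!
# Route `UnitScaleTilt`, crux K1 child «MinimiserStabilityRegPr» (stmt-QuantumFields-19200), registered stub `stub_halvingStep` (H) — pillar P1♭ `core′`,
# LEAD-H junction **J1c «TOP-CUBE GEOMETRY PACK»** (LEAD-H 11:36:33Z (3)): (a) the two `Near := □₀` clauses `hNearIdx` ∕ `hNearΩ` of
# ✓`HalvingCompetitorMapFibreLocal.exists_gaugeAct_mem_fibre_of_chart49` AT THE MEMBER `Dm := cubeSeqMT3 F n K x ρ S M hM`,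
# `Near b := b.src ∈ cubeSetM x (K−n) ρ S M 0 ∧ b.tgt ∈ cubeSetM x (K−n) ρ S M 0`; (b) the top-cube box letters `h0 ∕ hlohi ∕ hc ∕ hce` of
# lit ✓`B10Eq27TorusAxialLog.norm_holT_contourT_sub_one_le` with `lo := −(ρ+M−1)·𝟙`, `hi := (ρ+M)·𝟙` about `y₀ := iterBlockOf (K−n) x`

Cell `ym3-torus` ∕ `pub/ym-inputs`, seat `ym-inputs-p09`.  `--supports stmt-QuantumFields-19200 --as helper`; THEOREMS ONLY (0 `def`, 0 `sorry`); count-neutral; nothing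
here claims the stub, the crux, d = 4 or the mass gap — YM₃ on T³ is a ladder rung (R3), not the Clay problem.

WHAT IS PROVED (def-free; CONSUMED BY NAME: `FlatCubeSequenceAligned.cubeSeqMT3 ∕ cubeSeqM_Om_pos ∕ cubeSetM ∕ cubeFinM ∕ radM ∕ blockOf_mem_cubeFinM ∕
mem_cubeFinM_of_dist ∕ dist_le_of_mem_cubeFinM ∕ natAbs_valMinAbs_sub_le_of_div_eq`, `FlatCubeSequence.distSite_le_blockOf`, `FlatCubeQContraction.distSite_shift_le_one`,
`HalvingP1FlatPillarPrime.mem_cubeSetM_zero_iff`, `B6SectADomainsV1.Domains.LamBond`, `B10Eq27TorusAxialLog.rel`, `B7Prop1Local.InBox`, `B7Prop1Explicit.e`):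
* §1 (generic `P : Params`, aligned cube tower `cubeSetM x₀ k ρ S M`, `k ≤ m + K`, `1 ≤ M`): ★`mem_cubeSetM_zero_of_dist_le` — a fine site whose `j`-block is within
  the BALL radius `radM (k−j)` of `Bʲx₀` lies in `□₀` (induction on `j` through ✓`blockOf_mem_cubeFinM`); `mem_cubeSetM_zero_of_mem_cubeSetM` (`□_j ⊆ □₀`, every `j ≤ k`);
  ★`dist_le_radM_of_blockOf_near` — THE ONE-STEP COLLAR under the separation floor `L ≤ S`: a `j`-site whose `(j+1)`-block is within `radM (k−j−1) + M` (one more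
  than a member) of `Bʲ⁺¹x₀` is within `radM (k−j)` of `Bʲx₀` (`L·(radM + M) + L − 1 ≤ L·radM + (LM − 1) + S`); `mem_cubeSetM_zero_of_near_mem` — every fine site
  whose `j`-block (`j ≥ 1`) is within distance `1` of a member of `□_j` lies in `□₀`.
* §2 (the member `cubeSeqMT3 F n K x ρ S M hM`): ★★`near_of_mem_Om_succ` = the `hNearΩ` clause VERBATIM (no floor), ★★`near_of_bondIdx` = the `hNearIdx` clause
  VERBATIM under `F.L ≤ S` (a level-`j` index bond has one end in `Ω_j` (`Domains.LamBond`), the other within distance `1`).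
* §3 (generic, top level `k`, `y₀ := iterBlockOf k x₀`): `natAbs_rel_le_of_mem_top` (`|rel y₀ y|_μ ≤ ρ + M − 1` on `□_k = cubeFinM … k`, the `M`-saturated `ρ`-ball),
  `inBox_rel_of_mem_top` (`hc`), `inBox_rel_add_e_of_mem_top` (`hce`, bonds with source in `□_k`), `inBox_zero_top` (`h0`), `lo_le_hi_top` (`hlohi`); and the member
  forms `inBox_rel_of_mem_Om_top` ∕ `inBox_rel_add_e_of_mem_Om_top` (`n < K`).  The no-wrap companion `(rel + 1)·2 ≤ sitesPerDir (K−n)` under the room premise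
  `ρ + M ≤ L^{m+n}` is ✓`HalvingP1FlatCoreDP1Target.two_mul_rel_succ_le_of_room` (not restated).
HONEST SCOPE: geometry bookkeeping on the route's cube tower; nothing here proves `core′`, the stub or the crux.

References: T. Bałaban, CMP **102** (1985) 277–309 [Balaban1985Variational] ((144) p.300); CMP **96** (1984) 223–250 [Balaban1984PropagatorsII] ((2.1)–(2.4)
p.224); CMP **98** (1985) 17–51 [Balaban1985Averaging] ((8) p.19, pp.24–25).
-/

set_option autoImplicit false

namespace Summit.QuantumFields.YangMills.Theorems.P1FlatCoreTopCubeGeometry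

open Literature.MathematicalPhysics.QuantumFieldTheory.Balaban1983to89
open Literature.MathematicalPhysics.QuantumFieldTheory.Balaban1983to89.T3ContinuumYM3Torus (T3Family)
open B5Eq117TorusCarriers (Mk)
open B5Eq118OneStroke (iterBlockOf iterBlockOf_zero iterBlockOf_succ)
open B5Prop12FieldsLattice (distSite distSite_nonneg distSite_self)
open B5RowSumsP12Lattice (distSite_comm distSite_triangle)
open B6SectADomainsV1 (Domains)
open B6SectAOperatorsV1 (BondIdx)
open B7Prop1Explicit (e e_apply)
open B7Prop1Local (InBox)
open B10Eq27TorusAxialLog (rel rel_apply)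
open FlatCubeSequence (distSite_le_blockOf)
open FlatCubeSequenceAligned (cubeSeqMT3 cubeSeqM cubeSeqM_Om_pos cubeSetM cubeFinM radM radM_succ mem_cubeFinM_iff mem_cubeFinM_of_dist
  dist_le_of_mem_cubeFinM blockOf_mem_cubeFinM natAbs_valMinAbs_sub_le_of_div_eq)
open HalvingP1FlatPillarPrime (mem_cubeSetM_zero_iff)
open FlatCubeQContraction (distSite_shift_le_one)

/-! ## §1 `□₀` contains every block column over the cube tower (generic carrier) -/

section Generic

variable {P : Params} {x₀ : Site P 0} {k ρ S M : ℕ}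

/-- ★ **BALL COLUMNS LIE IN `□₀`**: if the `j`-block of `x′` is within the ball radius `radM (k−j)` of `Bʲx₀` (`j ≤ k ≤ m + K`, `1 ≤ M`) then `x′ ∈ □₀`
— induction on `j` through the one-level nesting ✓`blockOf_mem_cubeFinM`. [cite: Balaban1985Variational, (144) p.300; Balaban1984PropagatorsII, (2.1) p.224] -/
theorem mem_cubeSetM_zero_of_dist_le (hM : 1 ≤ M) (hk : k ≤ P.m + P.K) :
    ∀ {j : ℕ}, j ≤ k → ∀ {x' : Site P 0}, distSite (Mk P j) (iterBlockOf j x') (iterBlockOf j x₀) ≤ (radM P.L M ρ S (k - j) : ℝ) →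
      x' ∈ cubeSetM x₀ k ρ S M 0
  | 0, _, x', hd => by
    rw [mem_cubeSetM_zero_iff]
    exact mem_cubeFinM_of_dist x₀ k ρ S M 0 hd
  | j + 1, hjk, x', hd => by
    have hy : blockOf (iterBlockOf j x') ∈ cubeFinM x₀ k ρ S M (j + 1) := mem_cubeFinM_of_dist x₀ k ρ S M (j + 1) hd
    exact mem_cubeSetM_zero_of_dist_le hM hk (Nat.le_of_succ_le hjk) (blockOf_mem_cubeFinM hM hk hjk hy)

/-- **`□_j ⊆ □₀`** for every `j ≤ k` (`k ≤ m + K`, `1 ≤ M`). [cite: Balaban1985Variational, (144) p.300; Balaban1984PropagatorsII, (2.1) p.224] -/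
theorem mem_cubeSetM_zero_of_mem_cubeSetM (hM : 1 ≤ M) (hk : k ≤ P.m + P.K) {j : ℕ} (hjk : j ≤ k) {x' : Site P 0}
    (hx' : x' ∈ cubeSetM x₀ k ρ S M j) : x' ∈ cubeSetM x₀ k ρ S M 0 := by
  rcases j with _ | j
  · exact hx'
  · have hy : blockOf (iterBlockOf j x') ∈ cubeFinM x₀ k ρ S M (j + 1) := by
      simpa only [cubeSetM, hjk, if_true, Set.mem_setOf_eq, iterBlockOf_succ] using hx'
    exact mem_cubeSetM_zero_of_dist_le hM hk (Nat.le_of_succ_le hjk) (blockOf_mem_cubeFinM hM hk hjk hy)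

/-- ★ **THE ONE-STEP COLLAR under the separation floor `L ≤ S`**: if the `(j+1)`-block of `y` is within `radM (k−j−1) + M` of `Bʲ⁺¹x₀` (one more than every
member of `□_{j+1}` is) then `y` is within the ball radius `radM (k−j)` of `Bʲx₀` — `L·(radM + M) + (L − 1) ≤ L·radM + (L·M − 1) + S`.
[cite: Balaban1985Variational, (144) p.300; Balaban1984PropagatorsII, (2.2) p.224] -/
theorem dist_le_radM_of_blockOf_near (hM : 1 ≤ M) (hk : k ≤ P.m + P.K) (hLS : P.L ≤ S) {j : ℕ} (hjk : j + 1 ≤ k) {y : Site P j}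
    (hy : distSite (Mk P (j + 1)) (blockOf y) (iterBlockOf (j + 1) x₀) ≤ (radM P.L M ρ S (k - (j + 1)) : ℝ) + M) :
    distSite (Mk P j) y (iterBlockOf j x₀) ≤ (radM P.L M ρ S (k - j) : ℝ) := by
  have hj : j + 1 ≤ P.m + P.K := hjk.trans hk
  have hkj : k - j = (k - (j + 1)) + 1 := by omega
  have hL0 : (0 : ℝ) ≤ P.L := Nat.cast_nonneg _
  have hS : (P.L : ℝ) ≤ S := by exact_mod_cast hLS
  calc distSite (Mk P j) y (iterBlockOf j x₀)
      ≤ (P.L : ℝ) * distSite (Mk P (j + 1)) (blockOf y) (blockOf (iterBlockOf j x₀)) + ((P.L : ℝ) - 1) :=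
        distSite_le_blockOf hj y (iterBlockOf j x₀)
    _ ≤ (P.L : ℝ) * ((radM P.L M ρ S (k - (j + 1)) : ℝ) + M) + ((P.L : ℝ) - 1) := by
        rw [← iterBlockOf_succ]
        have := mul_le_mul_of_nonneg_left hy hL0
        linarith
    _ ≤ (radM P.L M ρ S (k - j) : ℝ) := by
        rw [hkj, radM_succ]
        have hLM : 1 ≤ P.L * M := Nat.one_le_iff_ne_zero.mpr (Nat.mul_ne_zero P.L_pos.ne' (by omega))
        have hsub : ((P.L * M - 1 : ℕ) : ℝ) = (P.L : ℝ) * M - 1 := by rw [Nat.cast_sub hLM, Nat.cast_mul, Nat.cast_one]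
        push_cast
        rw [hsub]
        linarith

/-- **NEIGHBOURS OF MEMBERS HAVE THEIR COLUMNS IN `□₀`** (`1 ≤ j ≤ k ≤ m + K`, `1 ≤ M`, `L ≤ S`): if `y ∈ □_j`, `dist_j(y′, y) ≤ 1` and the `j`-block of `x′`
is `y′`, then `x′ ∈ □₀`. [cite: Balaban1985Variational, (144) p.300; Balaban1984PropagatorsII, (2.2) p.224] -/
theorem mem_cubeSetM_zero_of_near_mem (hM : 1 ≤ M) (hk : k ≤ P.m + P.K) (hLS : P.L ≤ S) {j : ℕ} (h1 : 1 ≤ j) (hjk : j ≤ k)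
    {y y' : Site P j} (hy : y ∈ cubeFinM x₀ k ρ S M j) (hyy' : distSite (Mk P j) y' y ≤ 1) {x' : Site P 0}
    (hx' : iterBlockOf j x' = y') : x' ∈ cubeSetM x₀ k ρ S M 0 := by
  obtain ⟨i, rfl⟩ : ∃ i, j = i + 1 := ⟨j - 1, by omega⟩
  have hd := dist_le_of_mem_cubeFinM hM hy
  have htri := distSite_triangle (Mk P (i + 1)) y' y (iterBlockOf (i + 1) x₀)
  have hnear : distSite (Mk P (i + 1)) (blockOf (iterBlockOf i x')) (iterBlockOf (i + 1) x₀) ≤ (radM P.L M ρ S (k - (i + 1)) : ℝ) + M := by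
    rw [← iterBlockOf_succ, hx']
    linarith
  exact mem_cubeSetM_zero_of_dist_le hM hk (Nat.le_of_succ_le hjk) (dist_le_radM_of_blockOf_near hM hk hLS hjk hnear)

end Generic

/-! ## §2 The `Near := □₀` clauses of `exists_gaugeAct_mem_fibre_of_chart49` at the member `cubeSeqMT3 F n K x ρ S M hM` -/

section Member

variable (F : T3Family) (n K : ℕ)

/-- ★★ **`hNearΩ` AT THE ALIGNED CUBE SEQUENCE** (no floor): both ends of a fine bond lying under one `Ω_{j+1}`-block are in `□₀`.
[cite: Balaban1985Variational, (144) p.300; Balaban1984PropagatorsII, (2.1) p.224] -/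
theorem near_of_mem_Om_succ (x : Site (F.P K) 0) (ρ S M : ℕ) (hM : 1 ≤ M) :
    ∀ (j : ℕ) (z : Site (F.P K) (j + 1)), z ∈ (cubeSeqMT3 F n K x ρ S M hM).Om (j + 1) → ∀ b : PBond (F.P K) 0,
      iterBlockOf (j + 1) b.src = z → iterBlockOf (j + 1) b.tgt = z →
        b.src ∈ cubeSetM x (K - n) ρ S M 0 ∧ b.tgt ∈ cubeSetM x (K - n) ρ S M 0 := by
  intro j z hz b hs ht
  have hk := FlatMinimizerH.le_T3 F n K
  by_cases hjk : j + 1 ≤ K - n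
  · have hOm : (cubeSeqMT3 F n K x ρ S M hM).Om (j + 1) = cubeFinM x (K - n) ρ S M (j + 1) :=
      cubeSeqM_Om_pos x hk ρ S M hM (Nat.succ_pos j) hjk
    rw [hOm] at hz
    have mem : ∀ x' : Site (F.P K) 0, iterBlockOf (j + 1) x' = z → x' ∈ cubeSetM x (K - n) ρ S M 0 := fun x' hx' =>
      mem_cubeSetM_zero_of_mem_cubeSetM hM hk hjk (by simp only [cubeSetM, hjk, if_true, Set.mem_setOf_eq]; rw [hx']; exact hz)
    exact ⟨mem _ hs, mem _ ht⟩
  · exfalso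
    have hlt : (cubeSeqMT3 F n K x ρ S M hM).k < j + 1 := by
      rw [FlatCubeSequenceAligned.cubeSeqMT3_k]; omega
    rw [(cubeSeqMT3 F n K x ρ S M hM).Om_eq_empty hlt] at hz
    simp at hz

/-- ★★ **`hNearIdx` AT THE ALIGNED CUBE SEQUENCE** under the separation floor `F.L ≤ S`: every fine bond in the read territory of a level-`j ≥ 1` index bond
`e ∈ Λ_j` (both ends under `e₋` or `e₊`) has both ends in `□₀` — one end of `e` lies in `Ω_j = □_j` (`Domains.LamBond`), the other within distance `1` of it.
[cite: Balaban1985Variational, (144) p.300; Balaban1984PropagatorsII, (2.2)–(2.3) p.224] -/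
theorem near_of_bondIdx (x : Site (F.P K) 0) (ρ S M : ℕ) (hM : 1 ≤ M) (hLS : F.L ≤ S) :
    ∀ idx : BondIdx (cubeSeqMT3 F n K x ρ S M hM), 1 ≤ (idx.1.1 : ℕ) → ∀ b : PBond (F.P K) 0,
      (iterBlockOf (idx.1.1 : ℕ) b.src = idx.1.2.src ∨ iterBlockOf (idx.1.1 : ℕ) b.src = idx.1.2.tgt) →
      (iterBlockOf (idx.1.1 : ℕ) b.tgt = idx.1.2.src ∨ iterBlockOf (idx.1.1 : ℕ) b.tgt = idx.1.2.tgt) →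
        b.src ∈ cubeSetM x (K - n) ρ S M 0 ∧ b.tgt ∈ cubeSetM x (K - n) ρ S M 0 := by
  intro idx h1 b hs ht
  obtain ⟨⟨j, eb⟩, he⟩ := idx
  have hk := FlatMinimizerH.le_T3 F n K
  have hLS' : (F.P K).L ≤ S := hLS
  have hjk : (j : ℕ) ≤ K - n := by
    have h2 := j.2
    have hkk : (cubeSeqMT3 F n K x ρ S M hM).k = K - n := rfl
    omega
  have hOm : (cubeSeqMT3 F n K x ρ S M hM).Om (j : ℕ) = cubeFinM x (K - n) ρ S M (j : ℕ) := cubeSeqM_Om_pos x hk ρ S M hM h1 hjk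
  have he' : eb.src ∈ cubeFinM x (K - n) ρ S M (j : ℕ) ∨ eb.tgt ∈ cubeFinM x (K - n) ρ S M (j : ℕ) := by
    have h := he.1
    rwa [hOm] at h
  have hd1 : distSite (Mk (F.P K) (j : ℕ)) eb.tgt eb.src ≤ 1 := by
    rw [distSite_comm]; exact distSite_shift_le_one eb.src eb.dir
  have hd1' : distSite (Mk (F.P K) (j : ℕ)) eb.src eb.tgt ≤ 1 := by rw [distSite_comm]; exact hd1
  have hd0 : ∀ y : Site (F.P K) (j : ℕ), distSite (Mk (F.P K) (j : ℕ)) y y ≤ 1 := fun y => by rw [distSite_self]; norm_num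
  have key : ∀ x' : Site (F.P K) 0, (iterBlockOf (j : ℕ) x' = eb.src ∨ iterBlockOf (j : ℕ) x' = eb.tgt) →
      x' ∈ cubeSetM x (K - n) ρ S M 0 := by
    intro x' hx'
    rcases he' with hsrc | htgt
    · rcases hx' with h | h
      · exact mem_cubeSetM_zero_of_near_mem hM hk hLS' h1 hjk hsrc (hd0 _) h
      · exact mem_cubeSetM_zero_of_near_mem hM hk hLS' h1 hjk hsrc hd1 h
    · rcases hx' with h | h
      · exact mem_cubeSetM_zero_of_near_mem hM hk hLS' h1 hjk htgt hd1' h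
      · exact mem_cubeSetM_zero_of_near_mem hM hk hLS' h1 hjk htgt (hd0 _) h
  exact ⟨key _ hs, key _ ht⟩

end Member

/-! ## §3 The top-cube box letters of `norm_holT_contourT_sub_one_le` (`lo := −(ρ+M−1)·𝟙`, `hi := (ρ+M)·𝟙`) -/

section Top

variable {P : Params} {x₀ : Site P 0} {k ρ S M : ℕ}

/-- **`|rel y₀ y|_μ ≤ ρ + M − 1` ON THE TOP CUBE** `□_k = cubeFinM x₀ k ρ S M k` (the `M`-saturated `ρ`-ball about `y₀ = Bᵏx₀`; `1 ≤ M`).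
[cite: Balaban1985Variational, (144) p.300; Balaban1985Averaging, (8) p.19] -/
theorem natAbs_rel_le_of_mem_top (hM : 1 ≤ M) {y : Site P k} (hy : y ∈ cubeFinM x₀ k ρ S M k) (μ : Fin P.d) :
    (rel (iterBlockOf k x₀) y μ).natAbs ≤ ρ + (M - 1) := by
  rw [mem_cubeFinM_iff] at hy
  obtain ⟨y₀, hlab, hdist⟩ := hy
  rw [Nat.sub_self] at hdist
  have h1 : ((y₀ μ - (iterBlockOf k x₀) μ).valMinAbs).natAbs ≤ ρ := by
    have hle := Finset.le_sup (f := fun ν : Fin P.d => ((y₀ ν - (iterBlockOf k x₀) ν).valMinAbs).natAbs) (Finset.mem_univ μ)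
    have hsup : ((Finset.univ.sup fun ν : Fin P.d => ((y₀ ν - (iterBlockOf k x₀) ν).valMinAbs).natAbs : ℕ) : ℝ) ≤ (ρ : ℝ) := hdist
    exact_mod_cast (Nat.cast_le.2 hle).trans hsup
  have h2 : ((y μ - y₀ μ).valMinAbs).natAbs ≤ M - 1 := by
    rw [← ZMod.natAbs_valMinAbs_neg, neg_sub]
    exact natAbs_valMinAbs_sub_le_of_div_eq hM (y₀ μ) (y μ) (hlab μ)
  rw [rel_apply]
  have hsplit : y μ - (iterBlockOf k x₀) μ = (y μ - y₀ μ) + (y₀ μ - (iterBlockOf k x₀) μ) := by abel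
  rw [hsplit]
  refine (ZMod.natAbs_valMinAbs_add_le _ _).trans ((Int.natAbs_add_le _ _).trans ?_)
  omega

/-- **`hc`: `rel y₀ y ∈ [lo, hi]`** for `y ∈ □_k`, `lo := −(ρ+M−1)·𝟙`, `hi := (ρ+M)·𝟙`. [cite: Balaban1985Averaging, pp.24–25; Balaban1985Variational, (144) p.300] -/
theorem inBox_rel_of_mem_top (hM : 1 ≤ M) {y : Site P k} (hy : y ∈ cubeFinM x₀ k ρ S M k) :
    InBox (fun _ => -((ρ : ℤ) + M - 1)) (fun _ => (ρ : ℤ) + M) (rel (iterBlockOf k x₀) y) := by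
  intro μ
  have h := natAbs_rel_le_of_mem_top hM hy μ
  constructor <;> simp only <;> omega

/-- **`hce`: `rel y₀ c₋ + e_μ ∈ [lo, hi]`** for a top bond `c` with `c₋ ∈ □_k` (this is why `hi = ρ + M`, one more than `−lo`).
[cite: Balaban1985Averaging, pp.24–25; Balaban1985Variational, (144) p.300] -/
theorem inBox_rel_add_e_of_mem_top (hM : 1 ≤ M) {c : PBond P k} (hc : c.src ∈ cubeFinM x₀ k ρ S M k) :
    InBox (fun _ => -((ρ : ℤ) + M - 1)) (fun _ => (ρ : ℤ) + M) (rel (iterBlockOf k x₀) c.src + e c.dir) := by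
  intro μ
  have h := natAbs_rel_le_of_mem_top hM hc μ
  rw [Pi.add_apply, e_apply]
  constructor <;> simp only <;> split_ifs <;> omega

/-- **`h0`: `0 ∈ [lo, hi]`** (`1 ≤ M`). [cite: Balaban1985Averaging, pp.24–25, bookkeeping] -/
theorem inBox_zero_top (hM : 1 ≤ M) (d : ℕ) : InBox (fun _ : Fin d => -((ρ : ℤ) + M - 1)) (fun _ => (ρ : ℤ) + M) 0 := by
  intro μ
  constructor <;> simp only [Pi.zero_apply] <;> omega

/-- **`hlohi`: `lo ≤ hi`** (`1 ≤ M`). [cite: Balaban1985Averaging, pp.24–25, bookkeeping] -/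
theorem lo_le_hi_top (hM : 1 ≤ M) (d : ℕ) : ∀ i : Fin d, (fun _ : Fin d => -((ρ : ℤ) + M - 1)) i ≤ (fun _ : Fin d => (ρ : ℤ) + M) i := by
  intro i
  simp only
  omega

end Top

/-! ## §3′ The same at the member's top level `Ω_{K−n}` (`n < K`) -/

section MemberTop

variable (F : T3Family) (n K : ℕ)

/-- **`hc` AT THE MEMBER**: `rel (B^{K−n}x) y ∈ [−(ρ+M−1)·𝟙, (ρ+M)·𝟙]` for every `y ∈ Ω_{K−n}` of `cubeSeqMT3 F n K x ρ S M hM` (`n < K`, `1 ≤ M`).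
[cite: Balaban1985Averaging, pp.24–25; Balaban1985Variational, (144) p.300] -/
theorem inBox_rel_of_mem_Om_top (hnK : n < K) (x : Site (F.P K) 0) (ρ S M : ℕ) (hM : 1 ≤ M) {y : Site (F.P K) (K - n)}
    (hy : y ∈ (cubeSeqMT3 F n K x ρ S M hM).Om (K - n)) :
    InBox (fun _ => -((ρ : ℤ) + M - 1)) (fun _ => (ρ : ℤ) + M) (rel (iterBlockOf (K - n) x) y) := by
  rw [show (cubeSeqMT3 F n K x ρ S M hM).Om (K - n) = cubeFinM x (K - n) ρ S M (K - n) from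
    cubeSeqM_Om_pos x (FlatMinimizerH.le_T3 F n K) ρ S M hM (by omega) le_rfl] at hy
  exact inBox_rel_of_mem_top hM hy

/-- **`hce` AT THE MEMBER**: `rel (B^{K−n}x) c₋ + e_{dir c} ∈ [−(ρ+M−1)·𝟙, (ρ+M)·𝟙]` for every top bond `c` with `c₋ ∈ Ω_{K−n}` (`n < K`, `1 ≤ M`).
[cite: Balaban1985Averaging, pp.24–25; Balaban1985Variational, (144) p.300] -/
theorem inBox_rel_add_e_of_mem_Om_top (hnK : n < K) (x : Site (F.P K) 0) (ρ S M : ℕ) (hM : 1 ≤ M) {c : PBond (F.P K) (K - n)}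
    (hc : c.src ∈ (cubeSeqMT3 F n K x ρ S M hM).Om (K - n)) :
    InBox (fun _ => -((ρ : ℤ) + M - 1)) (fun _ => (ρ : ℤ) + M) (rel (iterBlockOf (K - n) x) c.src + e c.dir) := by
  rw [show (cubeSeqMT3 F n K x ρ S M hM).Om (K - n) = cubeFinM x (K - n) ρ S M (K - n) from
    cubeSeqM_Om_pos x (FlatMinimizerH.le_T3 F n K) ρ S M hM (by omega) le_rfl] at hc
  exact inBox_rel_add_e_of_mem_top hM hc

end MemberTop

end Summit.QuantumFields.YangMills.Theorems.P1FlatCoreTopCubeGeometry
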